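import Summits.ResolutionOfSingularities.ResolutionOfSingularities.Theses.UniformComplexity
import Summits.ResolutionOfSingularities.ResolutionOfSingularities.Theorems.UniversalCellsPrimeFieldToPerfectStubClimbAlgebraic
import Summits.ResolutionOfSingularities.ResolutionOfSingularities.Theorems.UniversalCellsPrimeFieldToPerfectClimbOfRatFuncPerf
import Mathlib.FieldTheory.IsAlgClosed.AlgebraicClosure
import Mathlib.FieldTheory.PurelyInseparable.PerfectClosure
import Mathlib.Algebra.CharP.IntermediateField
import Mathlib.Algebra.Algebra.ZMod
import Mathlib.FieldTheory.Finite.Basic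
import Mathlib.RingTheory.Finiteness.Cardinality
import HarnessLib

/-!
# Crux `PrimeModelTransfer` (stmt-ResolutionOfSingularities-8933) — line `shared-climb-kernel`

Crux strategist planner-cstrat-stmt-ResolutionOfSingularities-8933-r1-0, 2026-08-17 (REDIRECT r1).

**The crux.** `PrimeModelTransfer`: for a prime `p`, resolution of all integral separated
finite-type schemes over every algebraically closed field of characteristic `p` that is ALGEBRAIC
over `𝔽_p` (i.e. over `𝔽_p`-bar, the prime model of `ACF_p`) implies resolution of all integral
separated finite-type schemes over EVERY algebraically closed field `K` of characteristic `p`.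

**Verdict of the redirect scan: strictly WEAKER than the summit** (`S → C` is
`bc/PrimeModelTransfer_converse_manual.lean: summit_implies_primeModelTransfer`; `C → S` fails:
`C` only reaches integral schemes over ALGEBRAICALLY CLOSED fields, short of `S` by exactly the open
Descent cruxes `DescentAlgclosedToPerfect` (stmt-0550) and `DescentPerfectToAll` (stmt-0549)).

**The line (why-easier made checkable).** `K ⊇ k₀ := 𝔽_p-bar` (embed by `IsAlgClosed.lift`);
`k₀` is PERFECT and satisfies the crux hypothesis, so `IntegralResOver k₀`. A finite-type `X / K`
is defined over a subfield `k₀(s)`, `s ⊆ K` finite; resolve over the perfect closure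
`k₀(s)^{perf} ⊆ K` and base-change the (smooth!) resolution to `K`. Resolution over
`k₀(s)^{perf}` is reached from `k₀` by a finite TOWER of one-transcendental climbs
`M ↦ M(t)^{perf}` between perfect fields — and each climb is an instance of the OPEN TRANSFER
KERNEL of the sibling crux `UniversalCells.PrimeFieldToPerfect` (stmt-ResolutionOfSingularities-15233),
whose registered normal form (RESHAPE 4, `Cruxes/PrimeFieldToPerfect/Lines/birth.lean`) is
`stub_climbRatFuncPerf`: resolution over a perfect `M` of characteristic `p` ⇒ resolution over
every perfect `L` purely inseparable over `RatFunc M`. Hence: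

    PrimeModelTransfer_of : Sig.stub_climbRatFuncPerf → Sig.stub_towerFromPerfectBase →
        Sig.stub_descentToPerfectExtensions → PrimeModelTransfer        (PROVED below)

with THREE registered stubs:
* `stub_climbRatFuncPerf` — VERBATIM the one open registered stub of stmt-15233 (the shared
  kernel; open-problem sized; do NOT staff it twice — it rides on the 15233 lead, and when it lands
  this composition closes `PrimeModelTransfer` too);
* `stub_towerFromPerfectBase` — TRUE, size M: the landed `Theorems.PrimeFieldToPerfect.stub_tower`
  (p152147) transposed from the prime field `ZMod p` to an arbitrary PERFECT base `k₀` of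
  characteristic `p`, concluding at the perfect closure `pc(s) = perfectClosure k₀(s) E` inside a
  perfect `E ⊇ k₀` (same induction on the finite set `s`, same `tower_*` helper lemmas, which are
  already stated over a general base field);
* `stub_descentToPerfectExtensions` — TRUE, size S/M: the landed
  `Theorems.PrimeFieldToPerfect.stub_separableDescent` (p149298) / `stub_climbAlgebraic` (p154863)
  transposed: spread `X / E` out to `X₀ / K₀` (`Theorems.stub_fgModel`), `K₀ ⊆ k₀(s₀)`, resolve over
  `perfectClosure k₀(s₀) E` (hypothesis), regular over perfect ⇒ smooth, base change to `E`
  (`Theorems.stub_resolutionOfRobustModel`). Characteristic-free as stated.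

**Glue proved here (no sorry):** `climb_of_climbRatFuncPerf` (kernel ⇒ the one-transcendental
climb `Climb p`, by cases on `Transcendental M t`, through the LANDED
`Theorems.PrimeFieldToPerfect.climbTranscendental_of_climbRatFuncPerf` p156288 and
`stub_climbAlgebraic` p154863), `algebraicClosure_zmod_pow_eq_self` (`𝔽_p`-bar satisfies the
crux's algebraicity clause `∀ x, ∃ n > 0, x ^ p ^ n = x`), and the composition.

**Disproof used:** none on file for this crux (no `Cruxes/PrimeModelTransfer/Disproof.lean`;
refuter verdicts on stmt-8933: SURVIVES ×3). **Barriers:** no stub base-changes a resolution along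
an INSEPARABLE extension — stub 3 base-changes only SMOOTH models (from a perfect field), stub 2
never base-changes (it re-resolves at each perfect level through the kernel); the catalogued
`InseparableBaseChange`, `InseparableBaseChangeResolution`, `RegularNotGeometricallyRegular`,
`FrobeniusTwistResolution` bite only inside the kernel `stub_climbRatFuncPerf`, exactly as recorded
for stmt-15233 (KERNEL.md §3 there).
-/

noncomputable section

-- single-problem summit: the doubled namespace component `ResolutionOfSingularities` is forced
set_option linter.dupNamespace false

open CategoryTheory CategoryTheory.Limits AlgebraicGeometry Literature.AlgebraicGeometry.Resolution
open Summit.ResolutionOfSingularities.ResolutionOfSingularities.Theses.UniformComplexity (PrimeModelTransfer)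

namespace Summit.ResolutionOfSingularities.ResolutionOfSingularities.Cruxes.PrimeModelTransfer.SharedClimbKernel

/-! ## Predicates -/

/-- **Resolution of integral separated schemes of finite type over `Spec R`.**
[cite: Kollar2007, Ch. 3 (the problem in char p)] -/
def IntegralResOver (R : Type) [CommRing R] : Prop :=
  ∀ (X : Scheme.{0}) (f : X ⟶ Spec (.of R)), IsSeparated f → LocallyOfFiniteType f →
    QuasiCompact f → IsIntegral X → Scheme.HasResolution X

/-- **`Climb p` — the one-transcendental climb between perfect fields** (verbatim the kernel
predicate of `Cruxes/PrimeFieldToPerfect/Lines/birth.lean`): a perfect `M` of characteristic `p`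
with `IntegralResOver M`, a perfect `L ⊇ M` of characteristic `p` algebraic over `M(t)` for some
`t ∈ L` ⇒ `IntegralResOver L`. [cite: arXiv:1708.04268, Thm 1.1 and §2.4 (Patakfalvi–Waldron)] -/
def Climb (p : ℕ) : Prop :=
  ∀ (M : Type) [Field M] [CharP M p] [PerfectField M], IntegralResOver M →
    ∀ (L : Type) [Field L] [CharP L p] [PerfectField L] [Algebra M L] (t : L),
      Algebra.IsAlgebraic (IntermediateField.adjoin M ({t} : Set L)) L → IntegralResOver L

/-! ## The stub STATEMENTS by name (`Sig.stub_<name>`, folded) -/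

/-- Statement of `stub_climbRatFuncPerf` — VERBATIM `Sig.stub_climbRatFuncPerf` of the sibling
crux stmt-ResolutionOfSingularities-15233 (RESHAPE 4): THE SHARED OPEN KERNEL.
[cite: arXiv:1708.04268, Thm 1.1 and §2.4 (Patakfalvi–Waldron)] -/
def Sig.stub_climbRatFuncPerf : Prop :=
  ∀ p : ℕ, p.Prime → ∀ (M : Type) [Field M] [CharP M p] [PerfectField M], IntegralResOver M →
    ∀ (L : Type) [Field L] [PerfectField L] [Algebra (RatFunc M) L]
      [IsPurelyInseparable (RatFunc M) L], IntegralResOver L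

/-- Statement of `stub_towerFromPerfectBase`: from a PERFECT base `k₀` of characteristic `p` with
`IntegralResOver k₀`, the climb `Climb p` reaches the perfect closure of every finitely generated
subextension `k₀(s)` of every perfect `E ⊇ k₀`. [cite: Kollar2007, 1.19 (Curves over nonperfect fields)] -/
def Sig.stub_towerFromPerfectBase : Prop :=
  ∀ p : ℕ, p.Prime → ∀ (k₀ : Type) [Field k₀] [CharP k₀ p] [PerfectField k₀],
    IntegralResOver k₀ → Climb p →
    ∀ (E : Type) [Field E] [CharP E p] [PerfectField E] [Algebra k₀ E] (s : Finset E),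
      IntegralResOver (perfectClosure (IntermediateField.adjoin k₀ (↑s : Set E)) E)

/-- Statement of `stub_descentToPerfectExtensions`: over a perfect `E ⊇ k₀`, resolution over the
perfect closures `perfectClosure k₀(s) E` of all finitely generated subextensions gives
`IntegralResOver E` (finite-type descent + smooth base change).
[cite: EGAIV3, Thm. 8.8.2 (ii); Liu2002, Prop. 3.2.7 and Cor. 4.3.33] -/
def Sig.stub_descentToPerfectExtensions : Prop :=
  ∀ (k₀ : Type) [Field k₀] (E : Type) [Field E] [PerfectField E] [Algebra k₀ E],
    (∀ s : Finset E, IntegralResOver (perfectClosure (IntermediateField.adjoin k₀ (↑s : Set E)) E)) →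
    IntegralResOver E

/-! ## The stubs (registered signatures: every file-local predicate unfolded) -/

/-- **STUB 1 (THE SHARED OPEN KERNEL — verbatim `stub_climbRatFuncPerf` of stmt-15233, RESHAPE 4;
open-problem sized; NOT to be staffed separately).** `M` perfect of characteristic `p` with
resolution of all integral separated finite-type `M`-schemes, `L` perfect and purely inseparable
over `RatFunc M` (i.e. `L ≅ M(t)^{perf}`) ⇒ resolution of all integral separated finite-type
`L`-schemes. Why open: at every finite level `M(t^{p^{-n}}) ≅ M(t)` the hypothesis supplies only
REGULAR models, regular ⇏ smooth (`Literature.Barriers.ResolutionOfSingularities.RegularNotGeometricallyRegular`),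
and root-extraction + re-resolution has no termination argument in print beyond curves.
[cite: arXiv:1708.04268, Thm 1.1 and §2.4 (Patakfalvi–Waldron)] -/
theorem stub_climbRatFuncPerf (p : ℕ) (hp : p.Prime)
    (M : Type) [Field M] [CharP M p] [PerfectField M]
    (hM : ∀ (X : Scheme.{0}) (f : X ⟶ Spec (.of M)), IsSeparated f → LocallyOfFiniteType f →
      QuasiCompact f → IsIntegral X → Scheme.HasResolution X)
    (L : Type) [Field L] [PerfectField L] [Algebra (RatFunc M) L]
    [IsPurelyInseparable (RatFunc M) L]
    (X : Scheme.{0}) (f : X ⟶ Spec (.of L)) (hs : IsSeparated f) (hl : LocallyOfFiniteType f)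
    (hq : QuasiCompact f) (hX : IsIntegral X) : Scheme.HasResolution X := by
  sorry

/-- **STUB 2 (TRUE, size M — the tower from a perfect base).** `k₀` perfect of characteristic `p`
with resolution of all integral separated finite-type `k₀`-schemes; the one-transcendental climb
between perfect fields of characteristic `p` (hypothesis `hc`, = `Climb p`); `E ⊇ k₀` perfect of
characteristic `p`, `s ⊆ E` finite ⇒ resolution of all integral separated finite-type schemes over
the perfect closure `perfectClosure k₀(s) E = {x ∈ E | ∃ n, x^{p^n} ∈ k₀(s)}`. Proof plan = the
landed `Theorems.PrimeFieldToPerfect.stub_tower` (p152147) with `ZMod p` replaced by `k₀`: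
induction on `s` through the perfect subfields `pc(S)`, `S ⊆ s` (helper lemmas
`tower_perfectField_of_forall_mem_iff`, `tower_exists_forall_mem_iff`,
`tower_mem_adjoin_simple_of_mem_adjoin_insert`, `tower_isAlgebraic_of_forall_pow_mem` are already
stated over a general base field); base case: climb from `k₀` to `pc(∅)` with `t = 0`; last step:
`pc(s)` IS the target (`mem_perfectClosure_iff_pow_mem`, `ringExpChar = p`).
[cite: Kollar2007, 1.19 (Curves over nonperfect fields)] -/
theorem stub_towerFromPerfectBase (p : ℕ) (hp : p.Prime)
    (k₀ : Type) [Field k₀] [CharP k₀ p] [PerfectField k₀]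
    (h₀ : ∀ (X : Scheme.{0}) (f : X ⟶ Spec (.of k₀)), IsSeparated f → LocallyOfFiniteType f →
      QuasiCompact f → IsIntegral X → Scheme.HasResolution X)
    (hc : ∀ (M : Type) [Field M] [CharP M p] [PerfectField M],
      (∀ (X : Scheme.{0}) (f : X ⟶ Spec (.of M)), IsSeparated f → LocallyOfFiniteType f →
        QuasiCompact f → IsIntegral X → Scheme.HasResolution X) →
      ∀ (L : Type) [Field L] [CharP L p] [PerfectField L] [Algebra M L] (t : L),
        Algebra.IsAlgebraic (IntermediateField.adjoin M ({t} : Set L)) L →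
        ∀ (X : Scheme.{0}) (f : X ⟶ Spec (.of L)), IsSeparated f → LocallyOfFiniteType f →
          QuasiCompact f → IsIntegral X → Scheme.HasResolution X)
    (E : Type) [Field E] [CharP E p] [PerfectField E] [Algebra k₀ E] (s : Finset E)
    (X : Scheme.{0})
    (f : X ⟶ Spec (.of (perfectClosure (IntermediateField.adjoin k₀ (↑s : Set E)) E)))
    (hs : IsSeparated f) (hl : LocallyOfFiniteType f) (hq : QuasiCompact f) (hX : IsIntegral X) :
    Scheme.HasResolution X := by
  sorry

/-- **STUB 3 (TRUE, size S/M — finite-type descent to the perfect closures of finitely generated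
subextensions).** `E ⊇ k₀` perfect; if integral separated finite-type schemes over
`perfectClosure k₀(s) E` are resolvable for every finite `s ⊆ E`, then so are those over `E`.
Proof plan = the landed `Theorems.PrimeFieldToPerfect.stub_separableDescent` (p149298) transposed:
spread `X` out to `X₀ / K₀`, `K₀ = Subfield.closure s₀` (`Theorems.stub_fgModel`); `K₀ ≤ k₀(s₀) ≤
L := perfectClosure k₀(s₀) E` as subfields of `E`; `X₀ ×_{K₀} L` is integral (it is dominated by
the integral `X = X₀ ×_{K₀} E`, reduced by flat descent) hence resolvable by hypothesis; its
resolution is regular of finite type over the PERFECT `L`, hence smooth, so its base change to `E`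
is regular, proper and birational onto `X` (`Theorems.stub_resolutionOfRobustModel`).
Characteristic-free. [cite: EGAIV3, Thm. 8.8.2 (ii); Liu2002, Prop. 3.2.7 and Cor. 4.3.33] -/
theorem stub_descentToPerfectExtensions (k₀ : Type) [Field k₀]
    (E : Type) [Field E] [PerfectField E] [Algebra k₀ E]
    (h : ∀ (s : Finset E) (X : Scheme.{0})
      (f : X ⟶ Spec (.of (perfectClosure (IntermediateField.adjoin k₀ (↑s : Set E)) E))),
      IsSeparated f → LocallyOfFiniteType f → QuasiCompact f → IsIntegral X →
        Scheme.HasResolution X)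
    (X : Scheme.{0}) (f : X ⟶ Spec (.of E)) (hs : IsSeparated f) (hl : LocallyOfFiniteType f)
    (hq : QuasiCompact f) (hX : IsIntegral X) : Scheme.HasResolution X := by
  sorry

/-! ## Glue (PROVED) -/

/-- **The shared kernel gives the one-transcendental climb** (copy of RESHAPE 4's
`stub_climbTranscendental_of_ratFuncPerf` + RESHAPE 3's `stub_climb_of_cases` of the sibling
skeleton, through the LANDED `Theorems.PrimeFieldToPerfect.climbTranscendental_of_climbRatFuncPerf`
(p156288) and `Theorems.PrimeFieldToPerfect.stub_climbAlgebraic` (p154863)): by cases on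
`Transcendental M t`; in the algebraic case `M(t)/M` is finite and `L/M(t)` algebraic, so `L/M` is
algebraic and the landed algebraic climb applies. [folklore] -/
theorem climb_of_climbRatFuncPerf (hR : Sig.stub_climbRatFuncPerf) : ∀ p : ℕ, p.Prime → Climb p := by
  intro p hp M _ _ _ hM L _ _ _ _ t ht
  by_cases htr : Transcendental M t
  · intro X f hs hl hq hX
    exact _root_.Summit.ResolutionOfSingularities.ResolutionOfSingularities.Theorems.PrimeFieldToPerfect.climbTranscendental_of_climbRatFuncPerf
      (fun p hp M _ _ _ hM L _ _ _ _ X f hs hl hq hX => hR p hp M hM L X f hs hl hq hX)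
      p hp M hM L t htr ht X f hs hl hq hX
  · have halg : IsAlgebraic M t := by
      unfold Transcendental at htr
      exact Classical.not_not.mp htr
    haveI : FiniteDimensional M (IntermediateField.adjoin M ({t} : Set L)) :=
      IntermediateField.adjoin.finiteDimensional halg.isIntegral
    haveI : Algebra.IsAlgebraic M (IntermediateField.adjoin M ({t} : Set L)) :=
      Algebra.IsAlgebraic.of_finite M _
    haveI : Algebra.IsAlgebraic (IntermediateField.adjoin M ({t} : Set L)) L := ht
    haveI : Algebra.IsAlgebraic M L :=
      Algebra.IsAlgebraic.trans M (IntermediateField.adjoin M ({t} : Set L)) L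
    intro X f hs hl hq hX
    exact _root_.Summit.ResolutionOfSingularities.ResolutionOfSingularities.Theorems.PrimeFieldToPerfect.stub_climbAlgebraic
      M hM L X f hs hl hq hX

/-- **`𝔽_p`-bar satisfies the crux's algebraicity clause**: every `x ∈ AlgebraicClosure (ZMod p)`
satisfies `x ^ p ^ n = x` for some `n ≥ 1` (`𝔽_p(x)` is a finite field of cardinality `p ^ n`).
[folklore] -/
theorem algebraicClosure_zmod_pow_eq_self (p : ℕ) [Fact p.Prime] (x : AlgebraicClosure (ZMod p)) :
    ∃ n : ℕ, 0 < n ∧ x ^ p ^ n = x := by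
  classical
  let F : IntermediateField (ZMod p) (AlgebraicClosure (ZMod p)) :=
    IntermediateField.adjoin (ZMod p) ({x} : Set (AlgebraicClosure (ZMod p)))
  have hx : IsIntegral (ZMod p) x := (Algebra.IsAlgebraic.isAlgebraic x).isIntegral
  haveI : FiniteDimensional (ZMod p) F := IntermediateField.adjoin.finiteDimensional hx
  haveI : Finite F := Module.finite_of_finite (ZMod p)
  letI : Fintype F := Fintype.ofFinite F
  obtain ⟨n, -, hn⟩ := FiniteField.card F p
  refine ⟨n, n.pos, ?_⟩
  have hmem : x ∈ F := IntermediateField.mem_adjoin_simple_self (ZMod p) x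
  have key : (⟨x, hmem⟩ : F) ^ p ^ (n : ℕ) = ⟨x, hmem⟩ := by
    rw [← hn]
    exact FiniteField.pow_card _
  have := congrArg (fun y : F => (y : AlgebraicClosure (ZMod p))) key
  simpa using this

/-! ## The composition (kernel-checked; no `sorry` in its own term) -/

/-- **`PrimeModelTransfer` from the three stub statements** — PROVED. Fix `p` and an
algebraically closed `K` of characteristic `p`; `k₀ := AlgebraicClosure (ZMod p)` is algebraically
closed, of characteristic `p`, perfect, and algebraic over `𝔽_p` (`algebraicClosure_zmod_pow_eq_self`),
so the crux hypothesis gives `IntegralResOver k₀`; `K` is a `k₀`-algebra (`IsAlgClosed.lift`) and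
perfect; the kernel gives `Climb p` (`climb_of_climbRatFuncPerf`), the tower (stub 2) gives
resolution over every `perfectClosure k₀(s) K`, and the descent (stub 3) gives it over `K`.
[folklore] -/
theorem PrimeModelTransfer_of :
    Sig.stub_climbRatFuncPerf → Sig.stub_towerFromPerfectBase →
      Sig.stub_descentToPerfectExtensions → PrimeModelTransfer := by
  intro hR hT hD p hp hA K _ _ _ X f hs hl hq hX
  haveI : Fact p.Prime := ⟨hp⟩
  -- the prime model `k₀ = 𝔽_p`-bar
  let k₀ : Type := AlgebraicClosure (ZMod p)
  haveI : CharP k₀ p := charP_of_injective_algebraMap (algebraMap (ZMod p) k₀).injective p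
  have h₀ : IntegralResOver k₀ := fun Y g hs' hl' hq' hY =>
    hA k₀ (algebraicClosure_zmod_pow_eq_self p) Y g hs' hl' hq' hY
  -- `K ⊇ k₀`
  letI : Algebra (ZMod p) K := ZMod.algebra K p
  let ι : k₀ →ₐ[ZMod p] K := IsAlgClosed.lift
  letI : Algebra k₀ K := ι.toRingHom.toAlgebra
  -- climb, tower, descent
  have hcl : Climb p := climb_of_climbRatFuncPerf hR p hp
  exact hD k₀ K (fun s => hT p hp k₀ h₀ hcl K s) X f hs hl hq hX

/-- **The crux `PrimeModelTransfer`, assembled** — `PrimeModelTransfer_of` with the three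
registered stubs plugged in (their unfolded signatures are definitionally the `Sig.stub_*`); the
only `sorry`s in the closure are the three stubs. -/
theorem PrimeModelTransfer_proof : PrimeModelTransfer :=
  PrimeModelTransfer_of
    (fun p hp M _ _ _ hM L _ _ _ _ X f hs hl hq hX => stub_climbRatFuncPerf p hp M hM L X f hs hl hq hX)
    (fun p hp k₀ _ _ _ h₀ hc E _ _ _ _ s X f hs hl hq hX =>
      stub_towerFromPerfectBase p hp k₀ h₀ (fun M _ _ _ hM L _ _ _ _ t ht => hc M hM L t ht)
        E s X f hs hl hq hX)
    (fun k₀ _ E _ _ _ h X f hs hl hq hX => stub_descentToPerfectExtensions k₀ E h X f hs hl hq hX)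

end Summit.ResolutionOfSingularities.ResolutionOfSingularities.Cruxes.PrimeModelTransfer.SharedClimbKernel

end
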